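import Literature.Topology.FourManifolds.GompfFramedTwistOfTubeModel
import HarnessLib

/-!
# The twisted cylinder neighbourhood with a fat slab: the support condition at one level

Infrastructure for the framed form of R. Gompf, *More Cappell–Shaneson spheres are standard*,
Algebr. Geom. Topol. 10 (2010), Thm 2.1 / §4 ¶3 (the named fact
`Literature.Topology.FourManifolds.gompf2010_framedTwist`, **F**). The transfer and assembly
theorems for **F** (`exists_twistingDiffeo_transfer`, `GompfTwistLocality.lean`;
`gompf2010_framedTwist_of_tubeShearModel`, `GompfFramedTwistOfTubeModel.lean`;
`gompf2010_framedTwist_of_shearModel`, `GompfFramedTwistOfShearModel.lean`) ask that the fishtail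
twisting diffeomorphism be supported in the surgered image of the twisted cylinder neighbourhood
`twistNbhd ψ η V e e' = {[e_s x, s] | x ∈ V, s ∈ (0, 1)} ∪ T³ × (1 - η, 1 + η)` for every tube `V`
about the circle `α`, and only require `0 < η`. This file records the elementary observation that
makes that support condition cheap to verify: **for `η ≥ 1/2` the slab `T³ × (1 - η, 1 + η)` is the
whole second cylinder, so the neighbourhood is all of `X_ψ` except the fibre `{s = 1/2}` of the
first cylinder, of which it contains `{[e_{1/2} x, 1/2] | x ∈ V}`** — the thinness of the fishtail
neighbourhood in the tube `V` only has to be checked on that single fibre (there Gompf's disc is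
the cylinder over `α` and the construction is as thin as one likes).

* `Literature.Topology.FourManifolds.mem_bicollarPiece_of_half_le`,
  `Literature.Topology.FourManifolds.inr_mem_twistNbhd_of_half_le`,
  `Literature.Topology.FourManifolds.inl_mem_twistNbhd_of_ne_half`,
  `Literature.Topology.FourManifolds.inl_mem_twistNbhd_refl_of_mem` — membership in the
  neighbourhood for `η ≥ 1/2`;
* `Literature.Topology.FourManifolds.mem_twistNbhd_refl_of_half_le` — for the untwisted slide
  (`e = e' = refl`): a point of `X_ψ` lies in `twistNbhd ψ η V refl refl` as soon as it is not of
  the form `[x, 1/2]` with `x ∉ V`;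
* `Literature.Topology.FourManifolds.subset_localOpens_twistNbhd_of_half_le` — **the support
  criterion in the product-surgered sphere**: a set `K ⊆ prodSurgered ψ ε` lies in
  `localOpens (twistNbhd ψ η V refl refl)` as soon as every point of `K` off the new piece and on
  the fibre `s = 1/2` of the first cylinder has its `T³`-coordinate in `V` (the new piece
  `D̊² × 𝕊²` is contained in every `localOpens`).

Everything here is proved; no named facts are introduced.

## References

* R. E. Gompf, *More Cappell–Shaneson spheres are standard*, Algebr. Geom. Topol. 10 (2010)
  1665–1681, Thm 2.1 (proof: the bicollaring `I₀ × M` and the neighbourhood of the cylinder over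
  `α`) and §4 ¶3. [GompfAGT2010]
-/

open scoped Manifold ContDiff Topology Real
open Set Function

noncomputable section

namespace Literature.Topology.FourManifolds

/-- Local notation: `𝔼 n` is the model Euclidean space `EuclideanSpace ℝ (Fin n)`. -/
local notation "𝔼 " n:arg => EuclideanSpace ℝ (Fin n)

/-- Local notation: the model with corners `𝓣 = (𝓡 1).prod ((𝓡 1).prod (𝓡 1))` of `ThreeTorus`. -/
local notation "𝓣" =>
  (ModelWithCorners.prod (𝓡 1) (ModelWithCorners.prod (𝓡 1) (𝓡 1)))

section FatSlab

variable (ψ : ThreeTorus ≃ₘ⟮𝓣, 𝓣⟯ ThreeTorus) {η : ℝ} (V : TopologicalSpace.Opens ThreeTorus)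
  (K : Diffeotopy 𝓣 ThreeTorus) (φ₀ : ThreeTorus ≃ₘ⟮𝓣, 𝓣⟯ ThreeTorus)

/-- **For `η ≥ 1/2` the bicollar piece is the whole second cylinder** `T³ × (1/2, 3/2)`. [folklore] -/
theorem mem_bicollarPiece_of_half_le (hη : 1 / 2 ≤ η) (b : ThreeTorus × ↥mappingTorusPieceTwo) :
    b ∈ bicollarPiece η := by
  have hb : (b.2 : ℝ) ∈ Ioo (1 / 2 : ℝ) (3 / 2) := b.2.2
  rw [mem_bicollarPiece]
  exact ⟨by linarith [hb.1], by linarith [hb.2]⟩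

/-- For `η ≥ 1/2` every point of the second cylinder lies in the twisted cylinder neighbourhood. [folklore] -/
theorem inr_mem_twistNbhd_of_half_le (hη : 1 / 2 ≤ η) (b : ThreeTorus × ↥mappingTorusPieceTwo) :
    (mtGlueData ψ).inr b ∈ twistNbhd ψ η V K φ₀ :=
  bicollarMap_mem ψ η V K φ₀ ⟨b, mem_bicollarPiece_of_half_le hη b⟩

/-- **For `η ≥ 1/2` every point `[x, s]` of the first cylinder with `s ≠ 1/2` lies in the twisted
cylinder neighbourhood**: it is a point of the second cylinder (`[x, s] = [x, s]₂` for `s > 1/2`,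
`[x, s] = [ψ x, s + 1]₂` for `s < 1/2`). [folklore] -/
theorem inl_mem_twistNbhd_of_ne_half (hη : 1 / 2 ≤ η) (a : ThreeTorus × ↥mappingTorusPieceOne)
    (ha : (a.2 : ℝ) ≠ 1 / 2) : (mtGlueData ψ).inl a ∈ twistNbhd ψ η V K φ₀ := by
  have hs : (a.2 : ℝ) ∈ Ioo (0 : ℝ) 1 := a.2.2
  rcases lt_or_gt_of_ne ha with h | h
  · -- `s < 1/2`: the monodromy overlap
    let b : ThreeTorus × ↥mappingTorusPieceTwo :=
      (ψ a.1, ⟨(a.2 : ℝ) + 1, ⟨by linarith [hs.1], by linarith⟩⟩)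
    have hab : (mtGlueData ψ).inl a = (mtGlueData ψ).inr b :=
      (mappingTorusGlued_inl_eq_inr_iff _ _ a b).2 (Or.inr ⟨rfl, rfl⟩)
    rw [hab]
    exact inr_mem_twistNbhd_of_half_le ψ V K φ₀ hη b
  · -- `s > 1/2`: the identically glued overlap
    let b : ThreeTorus × ↥mappingTorusPieceTwo := (a.1, ⟨(a.2 : ℝ), ⟨h, by linarith [hs.2]⟩⟩)
    have hab : (mtGlueData ψ).inl a = (mtGlueData ψ).inr b :=
      (mappingTorusGlued_inl_eq_inr_iff _ _ a b).2 (Or.inl ⟨rfl, rfl⟩)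
    rw [hab]
    exact inr_mem_twistNbhd_of_half_le ψ V K φ₀ hη b

/-- For the untwisted slide, `[x, s]` lies in the neighbourhood whenever `x ∈ V` (any `η`, any `s`). [folklore] -/
theorem inl_mem_twistNbhd_refl_of_mem (η : ℝ) (a : ThreeTorus × ↥mappingTorusPieceOne) (ha : a.1 ∈ V) :
    (mtGlueData ψ).inl a ∈
      twistNbhd ψ η V (Diffeotopy.refl 𝓣 ThreeTorus) (Diffeomorph.refl 𝓣 ThreeTorus ∞) := by
  have h := cylMap_mem ψ η V (Diffeotopy.refl 𝓣 ThreeTorus) (Diffeomorph.refl 𝓣 ThreeTorus ∞)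
    ⟨a, (mem_cylPiece V).2 ha⟩
  have hslide : cylSlide (Diffeotopy.refl 𝓣 ThreeTorus) (Diffeomorph.refl 𝓣 ThreeTorus ∞) a = a :=
    Prod.ext (slideFun_refl _ _) rfl
  simpa only [cylMap, hslide] using h

/-- **Membership for a fat slab and the untwisted slide.** For `η ≥ 1/2`, a point of `X_ψ` lies in
`twistNbhd ψ η V refl refl` as soon as it is not a point `[x, 1/2]` of the first cylinder with
`x ∉ V`. [folklore] -/
theorem mem_twistNbhd_refl_of_half_le (hη : 1 / 2 ≤ η) {p : MTorus ψ}
    (hp : ∀ a : ThreeTorus × ↥mappingTorusPieceOne, (mtGlueData ψ).inl a = p → (a.2 : ℝ) = 1 / 2 → a.1 ∈ V) :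
    p ∈ twistNbhd ψ η V (Diffeotopy.refl 𝓣 ThreeTorus) (Diffeomorph.refl 𝓣 ThreeTorus ∞) := by
  rcases (mtGlueData ψ).exists_inl_or_inr p with ⟨a, rfl⟩ | ⟨b, rfl⟩
  · by_cases ha : (a.2 : ℝ) = 1 / 2
    · exact inl_mem_twistNbhd_refl_of_mem ψ V η a (hp a rfl ha)
    · exact inl_mem_twistNbhd_of_ne_half ψ V _ _ hη a ha
  · exact inr_mem_twistNbhd_of_half_le ψ V _ _ hη b

variable {ε : ℝ} (hε : 0 < ε) (hεπ : ε ≤ π) (hψ : ∀ v : 𝔼 3, ‖v‖ < ε → ψ (expT v) = expT v)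

/-- **The support criterion in the product-surgered sphere, fat slab.** For `η ≥ 1/2`, a set
`K ⊆ prodSurgered ψ ε` is contained in the surgered image `localOpens (twistNbhd ψ η V refl refl)` of
the twisted cylinder neighbourhood as soon as every point of `K` off the new piece which is a point
`[x, 1/2]` of the first cylinder has `x ∈ V`: the new piece `D̊² × 𝕊²` lies in every `localOpens`,
the second cylinder lies in the fat slab, and the first cylinder off the fibre `s = 1/2` is part of
the second. This is the only place where the thinness of Gompf's fishtail neighbourhood in the tube
`V` about `α` enters. [cite: GompfAGT2010, Thm 2.1 (proof: N ⊂ I₀ × M and the neighbourhood of the cylinder over α)] -/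
theorem subset_localOpens_twistNbhd_of_half_le (hη : 1 / 2 ≤ η) {Ks : Set (prodSurgered ψ ε hε hεπ hψ)}
    (hK : ∀ (a : ↥(prodTube ψ ε hε hεπ hψ).complement) (x : ThreeTorus × ↥mappingTorusPieceOne),
      (prodTube ψ ε hε hεπ hψ).glueData.inl a ∈ Ks → (a : MTorus ψ) = (mtGlueData ψ).inl x →
        (x.2 : ℝ) = 1 / 2 → x.1 ∈ V) :
    Ks ⊆ ((prodTube ψ ε hε hεπ hψ).localOpens
      (twistNbhd ψ η V (Diffeotopy.refl 𝓣 ThreeTorus) (Diffeomorph.refl 𝓣 ThreeTorus ∞)) : Set _) := by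
  intro z hz
  rcases (prodTube ψ ε hε hεπ hψ).glueData.exists_inl_or_inr z with ⟨a, rfl⟩ | ⟨d, rfl⟩
  · exact CircleNbhd.inl_mem_localOpens _
      (mem_twistNbhd_refl_of_half_le ψ V hη fun x hx hs ↦ hK a x hz hx.symm hs)
  · exact CircleNbhd.inr_mem_localOpens _ d

end FatSlab

end Literature.Topology.FourManifolds
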